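import Mathlib
import Summits.RiemannHypothesis.RiemannHypothesis.Theorems.IntegerScrewRootFlow
import Summits.RiemannHypothesis.RiemannHypothesis.Theorems.IntegerScrewMinFacSums
import HarnessLib

/-!
# Route `IntegerScrew` — PROP. K″, leg `α`: the root functional of the `Q`-rough hubs is `O((log Y·log log Y)/log²Q)·D`
# (CONTINUUM-LIMIT §27.2 (b α))

PROP. K″ routes the bottom's mass of a thin-bottom window through the HUBS `P ∈ (Q, Y]` (`Y = R/Q`) all of whose
primes exceed `Q`.  Its leg `α` moves mass from the root `1` to the hubs along their smallest-prime paths (every node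
of such a path is itself `Q`-rough); the load of the edge below a rough node `y` (`q′ = minFac y > Q`) is the harmonic
mass of the hubs using it, `≤ (1/y)·Π_{Q<q≤q′}(1 − 1/q)⁻¹ ≤ (1/y)·(1 + e⁵·log(q′+1)/log(Q+1))`
(`IntegerScrewPathUsers.sum_inv_rough_path_users_le`), and the general path-flow inequality
`IntegerScrewRootFlow.functional_sq_le_of_loads` gives

* `hubAlpha_sq_le_energy` — `(Σ_{P hub}(1/P)(g P − g 1))² ≤ [Σ_{y ≤ Y rough, y ≥ 2} A_y²/(y·log minFac y)]·D_{rough}(g)`,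
  `A_y = 1 + e⁵·log(minFac y + 1)/log(Q+1)`;
* **`hubAlpha_sq_le`** — for `1 ≤ Q`, `2 ≤ Y`:
  `(Σ_{P hub}(1/P)(g P − g 1))² ≤ (4(1+e⁵)²/log²(Q+1))·(log Y + log 4 + e⁵·log(Y+1)·(log log Y + 4))·D_{rough}(g)`
  (`A_y ≤ 2(1+e⁵)·log(minFac y)/log(Q+1)` and `IntegerScrewMinFacSums.sum_log_minFac_div_le`),

where `D_{rough}(g) = Σ_{2≤y≤Y, y Q-rough}(1/y)Σ_{n∣y}Λ(n)(g y − g(y/n))² ≤ D_{Ω_Y}(g)`.  With the hub mass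
`M ≥ log Y/(e⁵ log(Q+1)) − 1` (`IntegerScrewHubMass`) this is the `E_α ≍ L·log log R/(ℓ²M²)` of §27.2.
RH-free, elementary.  Nothing in this file bears on the truth of RH.
References: CONTINUUM-LIMIT §27.2 (rh-explicit A6-PIVOT); M. Suzuki, J. Lond. Math. Soc. (2) 108 (2023) 1448–1487
[Suzuki2023] for the screw matrices this serves.
-/

noncomputable section

set_option linter.dupNamespace false -- D-0017: `Summit.<S>.<S>.…` is the designed namespace

namespace Summit.RiemannHypothesis.RiemannHypothesis.Theorems.IntegerScrew

open Finset Real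
open ArithmeticFunction (vonMangoldt)

/-- **Leg `α` with its explicit energy**: for every `Q`, `Y`, `g`, with hubs `= {P ∈ (Q, Y] : every prime of P ≥ Q+1}`
and `A_y = 1 + e⁵·log(minFac y + 1)/log(Q+1)` (`Q ≥ 1`):
`(Σ_{P hub}(1/P)(g P − g 1))² ≤ [Σ_{2≤y≤Y, y rough} A_y²/(y·log minFac y)]·Σ_{2≤y≤Y, y rough}(1/y)Σ_{n∣y}Λ(n)(g y − g(y/n))²`. -/
theorem hubAlpha_sq_le_energy {Q : ℕ} (hQ : 1 ≤ Q) (Y : ℕ) (g : ℕ → ℝ) :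
    (∑ P ∈ (Ioc Q Y).filter (fun r => ∀ q ∈ r.primeFactors, Q + 1 ≤ q), (1 / (P : ℝ)) * (g P - g 1)) ^ 2 ≤
      (∑ y ∈ (Icc 2 Y).filter (fun r => ∀ q ∈ r.primeFactors, Q + 1 ≤ q),
          (1 + Real.exp 5 * Real.log ((y.minFac : ℝ) + 1) / Real.log ((Q : ℝ) + 1)) ^ 2 /
            ((y : ℝ) * Real.log y.minFac)) *
        ∑ y ∈ (Icc 2 Y).filter (fun r => ∀ q ∈ r.primeFactors, Q + 1 ≤ q),
          (1 / (y : ℝ)) * ∑ n ∈ y.divisors, (vonMangoldt n : ℝ) * (g y - g (y / n)) ^ 2 := by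
  set S := (Ioc Q Y).filter (fun r => ∀ q ∈ r.primeFactors, Q + 1 ≤ q) with hS
  set T := (Icc 2 Y).filter (fun r => ∀ q ∈ r.primeFactors, Q + 1 ≤ q) with hT
  have hS1 : ∀ x ∈ S, 1 ≤ x := fun x hx => by
    have := (Finset.mem_Ioc.1 (Finset.mem_filter.1 hx).1).1; omega
  have hST : ∀ x ∈ S, ∀ y ∈ pathSet x, y ∈ T := by
    intro x hx y hy
    obtain ⟨hxI, hxr⟩ := Finset.mem_filter.1 hx
    have hxI' := Finset.mem_Ioc.1 hxI
    have hb := mem_pathSet_bounds hy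
    have hdvd := (mem_pathSet hy).1
    refine Finset.mem_filter.2 ⟨Finset.mem_Icc.2 ⟨hb.1, hb.2.trans hxI'.2⟩, fun q hq => ?_⟩
    exact hxr q (Nat.primeFactors_mono hdvd (by omega) hq)
  have hT2 : ∀ y ∈ T, 2 ≤ y := fun y hy => (Finset.mem_Icc.1 (Finset.mem_filter.1 hy).1).1
  -- loads: the users of y among the hubs have quotients factored over [Q+1, minFac y]
  have hJ : ∀ y ∈ T, ∑ x ∈ S.filter (fun x => y ∈ pathSet x), (1 / (x : ℝ)) ≤
      (1 / (y : ℝ)) * (1 + Real.exp 5 * Real.log ((y.minFac : ℝ) + 1) / Real.log ((Q : ℝ) + 1)) := by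
    intro y hy
    have hy2 := hT2 y hy
    refine le_trans ?_ (sum_inv_rough_path_users_le (M := Y) (y := y) (Q := Q) (by omega) hQ)
    refine Finset.sum_le_sum_of_subset_of_nonneg ?_ fun x _ _ => by positivity
    intro x hx
    obtain ⟨hxS, hyx⟩ := Finset.mem_filter.1 hx
    obtain ⟨hxI, hxr⟩ := Finset.mem_filter.1 hxS
    have hxI' := Finset.mem_Ioc.1 hxI
    obtain ⟨hdvd, hsm⟩ := mem_pathSet hyx
    have hx0 : x ≠ 0 := by omega
    have hq0 : x / y ≠ 0 := (Nat.div_pos (Nat.le_of_dvd (by omega) hdvd) (by omega)).ne'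
    refine Finset.mem_filter.2 ⟨Finset.mem_Icc.2 ⟨by omega, hxI'.2⟩, hdvd, ?_⟩
    refine Nat.mem_factoredNumbers.2 ⟨hq0, fun q hq => ?_⟩
    have hq' := (Nat.mem_primeFactorsList hq0).1 hq
    refine Finset.mem_Icc.2 ⟨?_, ?_⟩
    · -- q ∣ x/y ∣ x, so q is a prime of x
      have hqx : q ∣ x := hq'.2.trans (Nat.div_dvd_of_dvd hdvd)
      exact hxr q (Nat.mem_primeFactors.2 ⟨hq'.1, hqx, hx0⟩)
    · have := (Nat.mem_smoothNumbers.1 hsm).2 q hq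
      omega
  exact functional_sq_le_of_loads S T hS1 hST hT2 _ hJ g

/-- The load factor on a rough node: for `Q ≥ 1`, `y ≥ 2` with `minFac y ≥ Q + 1`,
`(1 + e⁵·log(minFac y + 1)/log(Q+1))²/(y·log minFac y) ≤ (4(1+e⁵)²/log²(Q+1))·log(minFac y)/y`. -/
theorem hubAlpha_weight_le {Q y : ℕ} (hQ : 1 ≤ Q) (hy : 2 ≤ y) (hmf : Q + 1 ≤ y.minFac) :
    (1 + Real.exp 5 * Real.log ((y.minFac : ℝ) + 1) / Real.log ((Q : ℝ) + 1)) ^ 2 / ((y : ℝ) * Real.log y.minFac) ≤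
      4 * (1 + Real.exp 5) ^ 2 / Real.log ((Q : ℝ) + 1) ^ 2 * (Real.log y.minFac / y) := by
  set q : ℝ := (y.minFac : ℝ) with hq
  set l : ℝ := Real.log ((Q : ℝ) + 1) with hl
  have hqp : y.minFac.Prime := Nat.minFac_prime (by omega)
  have hq2 : (2 : ℝ) ≤ q := by rw [hq]; exact_mod_cast hqp.two_le
  have hQ1 : (2 : ℝ) ≤ (Q : ℝ) + 1 := by
    have : (1 : ℝ) ≤ Q := by exact_mod_cast hQ
    linarith
  have hl0 : 0 < l := Real.log_pos (by linarith)
  have hlogq : 0 < Real.log q := Real.log_pos (by linarith)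
  have hy0 : (0 : ℝ) < y := by exact_mod_cast (show 0 < y by omega)
  -- l ≤ log(q+1) and log(q+1) ≤ 2 log q
  have hlq1 : l ≤ Real.log (q + 1) := by
    have : (Q : ℝ) + 1 ≤ q := by rw [hq]; exact_mod_cast hmf
    exact Real.log_le_log (by linarith) (by linarith)
  have hq12 : Real.log (q + 1) ≤ 2 * Real.log q := by
    rw [← Real.log_rpow (by linarith), show (2 : ℝ) = (2 : ℕ) by norm_num, Real.rpow_natCast]
    exact Real.log_le_log (by linarith) (by nlinarith)
  -- A ≤ 2(1+e⁵) log q / l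
  have hA : 1 + Real.exp 5 * Real.log (q + 1) / l ≤ 2 * (1 + Real.exp 5) * Real.log q / l := by
    have h1 : (1 : ℝ) ≤ Real.log (q + 1) / l := by rw [le_div_iff₀ hl0]; linarith
    have h2 : Real.exp 5 * Real.log (q + 1) / l ≤ Real.exp 5 * (2 * Real.log q) / l :=
      div_le_div_of_nonneg_right (mul_le_mul_of_nonneg_left hq12 (Real.exp_pos 5).le) hl0.le
    have h3 : Real.log (q + 1) / l ≤ 2 * Real.log q / l := div_le_div_of_nonneg_right hq12 hl0.le
    have : 1 + Real.exp 5 * Real.log (q + 1) / l ≤ 2 * Real.log q / l + Real.exp 5 * (2 * Real.log q) / l := by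
      linarith
    calc 1 + Real.exp 5 * Real.log (q + 1) / l ≤ 2 * Real.log q / l + Real.exp 5 * (2 * Real.log q) / l := this
      _ = 2 * (1 + Real.exp 5) * Real.log q / l := by field_simp
  have hA0 : 0 ≤ 1 + Real.exp 5 * Real.log (q + 1) / l := by
    have : 0 ≤ Real.log (q + 1) := Real.log_nonneg (by linarith)
    positivity
  have hAsq : (1 + Real.exp 5 * Real.log (q + 1) / l) ^ 2 ≤ (2 * (1 + Real.exp 5) * Real.log q / l) ^ 2 :=
    pow_le_pow_left₀ hA0 hA 2
  calc (1 + Real.exp 5 * Real.log (q + 1) / l) ^ 2 / ((y : ℝ) * Real.log q)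
      ≤ (2 * (1 + Real.exp 5) * Real.log q / l) ^ 2 / ((y : ℝ) * Real.log q) :=
        div_le_div_of_nonneg_right hAsq (by positivity)
    _ = 4 * (1 + Real.exp 5) ^ 2 / l ^ 2 * (Real.log q / y) := by
        field_simp
        ring

/-- **PROP. K″, leg `α` (CONTINUUM-LIMIT §27.2 (b α))**: for `1 ≤ Q`, `2 ≤ Y` and every `g`,
`(Σ_{P ∈ (Q,Y], P Q-rough}(1/P)(g P − g 1))² ≤
  (4(1+e⁵)²/log²(Q+1))·(log Y + log 4 + e⁵·log(Y+1)·(log log Y + 4))·Σ_{2≤y≤Y, y Q-rough}(1/y)Σ_{n∣y}Λ(n)(g y − g(y/n))²`. -/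
theorem hubAlpha_sq_le {Q Y : ℕ} (hQ : 1 ≤ Q) (hY : 2 ≤ Y) (g : ℕ → ℝ) :
    (∑ P ∈ (Ioc Q Y).filter (fun r => ∀ q ∈ r.primeFactors, Q + 1 ≤ q), (1 / (P : ℝ)) * (g P - g 1)) ^ 2 ≤
      4 * (1 + Real.exp 5) ^ 2 / Real.log ((Q : ℝ) + 1) ^ 2 *
          (Real.log Y + Real.log 4 + Real.exp 5 * Real.log ((Y : ℝ) + 1) * (Real.log (Real.log Y) + 4)) *
        ∑ y ∈ (Icc 2 Y).filter (fun r => ∀ q ∈ r.primeFactors, Q + 1 ≤ q),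
          (1 / (y : ℝ)) * ∑ n ∈ y.divisors, (vonMangoldt n : ℝ) * (g y - g (y / n)) ^ 2 := by
  set T := (Icc 2 Y).filter (fun r => ∀ q ∈ r.primeFactors, Q + 1 ≤ q) with hT
  have h := hubAlpha_sq_le_energy hQ Y g
  have hD0 : 0 ≤ ∑ y ∈ T, (1 / (y : ℝ)) * ∑ n ∈ y.divisors, (vonMangoldt n : ℝ) * (g y - g (y / n)) ^ 2 :=
    Finset.sum_nonneg fun y _ => mul_nonneg (by positivity) (Finset.sum_nonneg fun n _ =>
      mul_nonneg ArithmeticFunction.vonMangoldt_nonneg (sq_nonneg _))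
  refine h.trans (mul_le_mul_of_nonneg_right ?_ hD0)
  -- Σ_T A²/(y log q′) ≤ C/l² · Σ_{Icc 2 Y} log(minFac y)/y ≤ C/l² · (…)
  have hC0 : 0 ≤ 4 * (1 + Real.exp 5) ^ 2 / Real.log ((Q : ℝ) + 1) ^ 2 := by positivity
  have hterm : ∀ y ∈ T, (1 + Real.exp 5 * Real.log ((y.minFac : ℝ) + 1) / Real.log ((Q : ℝ) + 1)) ^ 2 /
      ((y : ℝ) * Real.log y.minFac) ≤
        4 * (1 + Real.exp 5) ^ 2 / Real.log ((Q : ℝ) + 1) ^ 2 * (Real.log y.minFac / y) := by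
    intro y hy
    obtain ⟨hyI, hyr⟩ := Finset.mem_filter.1 hy
    have hy2 := (Finset.mem_Icc.1 hyI).1
    have hmf : Q + 1 ≤ y.minFac :=
      hyr _ (Nat.mem_primeFactors.2 ⟨Nat.minFac_prime (by omega), Nat.minFac_dvd y, by omega⟩)
    exact hubAlpha_weight_le hQ hy2 hmf
  refine (Finset.sum_le_sum hterm).trans ?_
  rw [← Finset.mul_sum]
  refine mul_le_mul_of_nonneg_left ?_ hC0
  refine le_trans ?_ (sum_log_minFac_div_le hY)
  refine Finset.sum_le_sum_of_subset_of_nonneg (Finset.filter_subset _ _) fun y hy _ => ?_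
  have hy2 := (Finset.mem_Icc.1 hy).1
  have : 0 < Real.log y.minFac := Real.log_pos (by exact_mod_cast (Nat.minFac_prime (by omega)).one_lt)
  positivity

end Summit.RiemannHypothesis.RiemannHypothesis.Theorems.IntegerScrew

end
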